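import Summits.AtomisticToContinuum.Crystallization.Theorems.ChargedEnergyGapChartDialE

/-!
# `ChargedEnergyGap` · the CHART DIAL, part F: SHELL-RADIUS COLLAR and CAP LEMMAS — decomp-a2c lens-3 g38 node «ScaleCoherence» (1/3)

Beneath `UpgradeWitness θ R M R'` (part D §4; the line beneath `ChartedChargePricing θ` is
`FarFieldPricing θ R ∧ UpgradeWitness θ R M R' ⟹ ChartedChargePricing θ`, `chartedChargePricing_of_far_upgrade`; first rung
`nearGrossCmp_of_core_in_shell`, part E).  Energy-free shell geometry only.  Node «ScaleCoherence» = parts F (this file),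
G (charted surround, one-hop Harnack) and H (second rung, the typed residual `ChainHarnack`, the assembly).

§1 THE COLLAR AT THE SHELL RADIUS IS A THEOREM (proved): `upgradeWitness_shell` (`UpgradeWitness θ (6/5) (1/5 − θ)⁻¹ R'`,
   `θ < 1/5`, `R' ≥ 6/5`), `collarPricing_shell`, and the trivial end of the `R`-dial
   `chartedChargePricing_iff_farField_shell : ChartedChargePricing θ ↔ FarFieldPricing θ (6/5)` — UPGRADE at radius `R` is
   exactly the price of pushing the far field's exclusion radius from `6/5` to `R`.
§2 CAP LEMMAS (proved): both kissing patterns meet every closed spherical cap of angular radius `45°`: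
   `∀ d, ∃ w ∈ P, ‖d‖ ≤ √2·⟪d, w⟫` (`exists_mem_fccKissingPattern_inner_ge`, `exists_mem_hcpKissingPattern_inner_ge`; the constant
   `1/√2` is sharp for both, attained at a coordinate axis).  FCC: the two largest `|coordinates|` with their signs; HCP: the
   same on the half-space `x + y + z ≥ 0` (the nine cuboctahedral vectors it shares with FCC), mirrored in the symmetry plane.
-/

noncomputable section

open Literature.MathematicalPhysics.StatisticalMechanics
open Literature.Geometry.DiscreteGeometry
open Summit.AtomisticToContinuum.Crystallization.Theses.PricedLinkCensus
open Summit.AtomisticToContinuum.Crystallization.Theorems.ChargedEnergyGapNegative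
open RealInnerProductSpace
namespace Summit.AtomisticToContinuum.Crystallization.Theorems.ChargedEnergyGapChartDial

/-! ## §1 The collar at the shell radius is a theorem -/

/-- At collar radius `R = 6/5` UPGRADE is its first rung: every near core lies in the shell ball. -/
theorem upgradeWitness_shell {θ R' : ℝ} (hθ1 : θ < 1 / 5) (hR' : 6 / 5 ≤ R') :
    UpgradeWitness θ (6 / 5) (1 / 5 - θ)⁻¹ R' := by
  intro Q x _ hx hn
  obtain ⟨y, g, hg, hC, hU, hd⟩ := hn
  exact nearGrossCmp_of_core_in_shell Q hθ1 hR' hg hC hU hx hd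

/-- COLLAR at the shell radius is a theorem (`θ < 1/5`). -/
theorem collarPricing_shell {θ : ℝ} (hθ1 : θ < 1 / 5) : CollarPricing θ (6 / 5) :=
  collarPricing_of_upgrade (M := (1 / 5 - θ)⁻¹) (R' := 6 / 5) (by norm_num) (inv_nonneg.2 (by linarith))
    (upgradeWitness_shell hθ1 le_rfl)

/-- **The trivial end of the `R`-dial**: at the shell radius P *is* the far field, `ChartedChargePricing θ ↔ FarFieldPricing θ (6/5)`
(`θ < 1/5`).  UPGRADE at radius `R > 6/5` is exactly the price of a wider defect-free zone for FAR. -/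
theorem chartedChargePricing_iff_farField_shell {θ : ℝ} (hθ1 : θ < 1 / 5) :
    ChartedChargePricing θ ↔ FarFieldPricing θ (6 / 5) :=
  ⟨farFieldPricing_of_chartedChargePricing (6 / 5), fun h => chartedChargePricing_of_far_collar h (collarPricing_shell hθ1)⟩

/-! ## §2 Cap lemmas: both kissing patterns meet every closed `45°` cap -/

section cap

/-- The inner product of `ℝ³` against an integer vector, in coordinates. -/
theorem inner_intVec_coord (d : E3) (v : Fin 3 → ℤ) :
    ⟪d, intVec v⟫ = d 0 * v 0 + d 1 * v 1 + d 2 * v 2 := by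
  simp [PiLp.inner_apply, Fin.sum_univ_three, mul_comm]

/-- The squared norm of `ℝ³` in coordinates. -/
private theorem norm_sq_coord (d : E3) : ‖d‖ ^ 2 = d 0 ^ 2 + d 1 ^ 2 + d 2 ^ 2 := by
  rw [EuclideanSpace.norm_eq, Real.sq_sqrt (by positivity), Fin.sum_univ_three]
  simp only [Real.norm_eq_abs, sq_abs]

/-- `m ≤ x` from `m² ≤ x²` for `x ≥ 0`. -/
private theorem le_of_sq_le_sq_of_nonneg {m x : ℝ} (hx : 0 ≤ x) (h : m ^ 2 ≤ x ^ 2) : m ≤ x := by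
  by_contra hc
  push Not at hc
  nlinarith [mul_lt_mul'' hc hc hx hx]

/-- Two largest absolute coordinates dominate the norm: `|c| ≤ |a|, |c| ≤ |b| ⟹ a² + b² + c² ≤ (|a| + |b|)²`. -/
theorem sq_sum_le_sq_abs_add {a b c : ℝ} (ha : |c| ≤ |a|) (hb : |c| ≤ |b|) :
    a ^ 2 + b ^ 2 + c ^ 2 ≤ (|a| + |b|) ^ 2 := by
  have h1 : c ^ 2 ≤ |a| * |b| := by
    calc c ^ 2 = |c| * |c| := by rw [← sq, sq_abs]
      _ ≤ |a| * |b| := mul_le_mul ha hb (abs_nonneg c) (abs_nonneg a)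
  nlinarith [sq_abs a, sq_abs b, abs_nonneg a, abs_nonneg b]

/-- The sign of a real as a unit integer. -/
def sgnZ (x : ℝ) : ℤ := if 0 ≤ x then 1 else -1

/-- `x·sgnZ x = |x|`. [this file] -/ theorem sgnZ_mul_eq_abs (x : ℝ) : x * (sgnZ x : ℝ) = |x| := by
  unfold sgnZ
  split_ifs with h
  · simp [abs_of_nonneg h]
  · push_cast
    rw [abs_of_neg (lt_of_not_ge h)]
    ring

/-- `sgnZ x ∈ {1, −1}`. [this file] -/ theorem sgnZ_cases (x : ℝ) : sgnZ x = 1 ∨ sgnZ x = -1 := by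
  unfold sgnZ; split_ifs <;> simp

/-- **FCC, integer form**: for every `d ∈ ℝ³` some minimal vector `v` of `D₃` has `⟪d, v⟫ ≥ ‖d‖` (`‖v‖ = √2`):
the two largest `|coordinates|` with their signs. -/
theorem exists_fccInt_inner_ge (d : E3) : ∃ v ∈ fccInt, ‖d‖ ≤ ⟪d, intVec v⟫ := by
  have hn := norm_nonneg d
  have hsq := norm_sq_coord d
  have m01 : ![sgnZ (d 0), sgnZ (d 1), 0] ∈ fccInt := by
    rcases sgnZ_cases (d 0) with h0 | h0 <;> rcases sgnZ_cases (d 1) with h1 | h1 <;> rw [h0, h1] <;> decide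
  have m02 : ![sgnZ (d 0), 0, sgnZ (d 2)] ∈ fccInt := by
    rcases sgnZ_cases (d 0) with h0 | h0 <;> rcases sgnZ_cases (d 2) with h1 | h1 <;> rw [h0, h1] <;> decide
  have m12 : ![0, sgnZ (d 1), sgnZ (d 2)] ∈ fccInt := by
    rcases sgnZ_cases (d 1) with h0 | h0 <;> rcases sgnZ_cases (d 2) with h1 | h1 <;> rw [h0, h1] <;> decide
  have i01 : ⟪d, intVec ![sgnZ (d 0), sgnZ (d 1), 0]⟫ = |d 0| + |d 1| := by
    rw [inner_intVec_coord]; simp [sgnZ_mul_eq_abs]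
  have i02 : ⟪d, intVec ![sgnZ (d 0), 0, sgnZ (d 2)]⟫ = |d 0| + |d 2| := by
    rw [inner_intVec_coord]; simp [sgnZ_mul_eq_abs]
  have i12 : ⟪d, intVec ![0, sgnZ (d 1), sgnZ (d 2)]⟫ = |d 1| + |d 2| := by
    rw [inner_intVec_coord]; simp [sgnZ_mul_eq_abs]
  rcases le_total |d 2| |d 0| with h20 | h02
  · rcases le_total |d 2| |d 1| with h21 | h12
    · refine ⟨_, m01, ?_⟩
      rw [i01]
      exact le_of_sq_le_sq_of_nonneg (by positivity) (by rw [hsq]; exact sq_sum_le_sq_abs_add h20 h21)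
    · refine ⟨_, m02, ?_⟩
      rw [i02]
      exact le_of_sq_le_sq_of_nonneg (by positivity)
        (by rw [hsq]; have := sq_sum_le_sq_abs_add (h12.trans h20) h12; linarith)
  · rcases le_total |d 0| |d 1| with h01 | h10
    · refine ⟨_, m12, ?_⟩
      rw [i12]
      exact le_of_sq_le_sq_of_nonneg (by positivity)
        (by rw [hsq]; have := sq_sum_le_sq_abs_add h01 h02; linarith)
    · refine ⟨_, m02, ?_⟩
      rw [i02]
      exact le_of_sq_le_sq_of_nonneg (by positivity)
        (by rw [hsq]; have := sq_sum_le_sq_abs_add h10 (h10.trans h02); linarith)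

/-- **CAP LEMMA, FCC**: the cuboctahedral kissing pattern meets every closed cap of angular radius `45°` —
for every `d` some pattern vector `w` has `⟪d, w⟫ ≥ ‖d‖/√2` (sharp: `d` a coordinate axis). -/
theorem exists_mem_fccKissingPattern_inner_ge (d : E3) :
    ∃ w ∈ fccKissingPattern, ‖d‖ ≤ Real.sqrt 2 * ⟪d, w⟫ := by
  obtain ⟨v, hv, h⟩ := exists_fccInt_inner_ge d
  have hmem : (Real.sqrt ((2 : ℕ) : ℝ))⁻¹ • intVec v ∈ fccKissingPattern := Finset.mem_image_of_mem _ hv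
  rw [Nat.cast_ofNat] at hmem
  refine ⟨_, hmem, ?_⟩
  rw [real_inner_smul_right, ← mul_assoc, mul_inv_cancel₀ (by positivity), one_mul]
  exact h

/-- **HCP, integer form on the upper half-space**: for `d` with `d₀ + d₁ + d₂ ≥ 0` one of the NINE cuboctahedral vectors
shared by the two patterns (hexagonal layer and upper triangle, scaled by `3` in `hcpInt`) has `⟪d, v⟫ ≥ 3‖d‖`. -/
theorem exists_hcpInt_inner_ge_of_sum_nonneg (d : E3) (hs : 0 ≤ d 0 + d 1 + d 2) :
    ∃ v ∈ hcpInt, v 0 + v 1 + v 2 ≥ 0 ∧ 3 * ‖d‖ ≤ ⟪d, intVec v⟫ := by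
  obtain ⟨v, hv, h⟩ := exists_fccInt_inner_ge d
  have hn := norm_nonneg d
  have hsq := norm_sq_coord d
  rw [inner_intVec_coord] at h
  simp only [fccInt, Finset.mem_insert, Finset.mem_singleton] at hv
  -- the nine good vectors map to `3v ∈ hcpInt`; the three lower ones force `d = 0`
  rcases hv with rfl | rfl | rfl | rfl | rfl | rfl | rfl | rfl | rfl | rfl | rfl | rfl <;>
    simp only [Matrix.cons_val_zero, Matrix.cons_val_one, Matrix.cons_val_two, Matrix.head_cons, Matrix.tail_cons,
      Int.cast_one, Int.cast_neg, Int.cast_zero] at h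
  · exact ⟨![3, 3, 0], by decide, by decide, by rw [inner_intVec_coord]; simp; linarith⟩
  · exact ⟨![3, -3, 0], by decide, by decide, by rw [inner_intVec_coord]; simp; linarith⟩
  · exact ⟨![-3, 3, 0], by decide, by decide, by rw [inner_intVec_coord]; simp; linarith⟩
  · -- `(-1,-1,0)`: `‖d‖ ≤ -(d 0 + d 1)` with `d 0 + d 1 + d 2 ≥ 0` forces `d 0 = d 1 = 0`, `‖d‖ = 0`… any vector works
    refine ⟨![3, 3, 0], by decide, by decide, ?_⟩
    rw [inner_intVec_coord]; simp
    have h2 : ‖d‖ ≤ d 2 := by linarith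
    have h3 : d 0 ^ 2 + d 1 ^ 2 ≤ 0 := by nlinarith
    have h0 : d 0 = 0 := by nlinarith [sq_nonneg (d 0), sq_nonneg (d 1)]
    have h1 : d 1 = 0 := by nlinarith [sq_nonneg (d 0), sq_nonneg (d 1)]
    rw [h0, h1] at h; rw [h0, h1]; linarith
  · exact ⟨![3, 0, 3], by decide, by decide, by rw [inner_intVec_coord]; simp; linarith⟩
  · exact ⟨![3, 0, -3], by decide, by decide, by rw [inner_intVec_coord]; simp; linarith⟩
  · exact ⟨![-3, 0, 3], by decide, by decide, by rw [inner_intVec_coord]; simp; linarith⟩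
  · refine ⟨![3, 0, 3], by decide, by decide, ?_⟩
    rw [inner_intVec_coord]; simp
    have h2 : ‖d‖ ≤ d 1 := by linarith
    have h3 : d 0 ^ 2 + d 2 ^ 2 ≤ 0 := by nlinarith
    have h0 : d 0 = 0 := by nlinarith [sq_nonneg (d 0), sq_nonneg (d 2)]
    have h1 : d 2 = 0 := by nlinarith [sq_nonneg (d 0), sq_nonneg (d 2)]
    rw [h0, h1] at h; rw [h0, h1]; linarith
  · exact ⟨![0, 3, 3], by decide, by decide, by rw [inner_intVec_coord]; simp; linarith⟩
  · exact ⟨![0, 3, -3], by decide, by decide, by rw [inner_intVec_coord]; simp; linarith⟩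
  · exact ⟨![0, -3, 3], by decide, by decide, by rw [inner_intVec_coord]; simp; linarith⟩
  · refine ⟨![0, 3, 3], by decide, by decide, ?_⟩
    rw [inner_intVec_coord]; simp
    have h2 : ‖d‖ ≤ d 0 := by linarith
    have h3 : d 1 ^ 2 + d 2 ^ 2 ≤ 0 := by nlinarith
    have h0 : d 1 = 0 := by nlinarith [sq_nonneg (d 1), sq_nonneg (d 2)]
    have h1 : d 2 = 0 := by nlinarith [sq_nonneg (d 1), sq_nonneg (d 2)]
    rw [h0, h1] at h; rw [h0, h1]; linarith

/-- **HCP, integer form**: for every `d ∈ ℝ³` some `v ∈ hcpInt` (`‖v‖ = 3√2`) has `⟪d, v⟫ ≥ 3‖d‖` — the lower half-space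
is the mirror image of the upper one in the symmetry plane `x + y + z = 0` of the anticuboctahedron. -/
theorem exists_hcpInt_inner_ge (d : E3) : ∃ v ∈ hcpInt, 3 * ‖d‖ ≤ ⟪d, intVec v⟫ := by
  by_cases hs : 0 ≤ d 0 + d 1 + d 2
  · obtain ⟨v, hv, -, h⟩ := exists_hcpInt_inner_ge_of_sum_nonneg d hs
    exact ⟨v, hv, h⟩
  · push Not at hs
    -- reflect `d` in the plane `x + y + z = 0`
    set s : ℝ := d 0 + d 1 + d 2 with hsdef
    set d' : E3 := d - (2 / 3 * s) • intVec ![1, 1, 1] with hd'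
    have hc : ∀ l : Fin 3, d' l = d l - 2 / 3 * s := by
      intro l; fin_cases l <;> simp [hd', intVec]
    have hs' : 0 ≤ d' 0 + d' 1 + d' 2 := by rw [hc, hc, hc]; linarith
    have hnorm : ‖d'‖ = ‖d‖ := by
      have h1 : ‖d'‖ ^ 2 = ‖d‖ ^ 2 := by
        rw [norm_sq_coord, norm_sq_coord, hc, hc, hc, hsdef]; ring
      nlinarith [norm_nonneg d, norm_nonneg d']
    obtain ⟨v, hv, hvs, h⟩ := exists_hcpInt_inner_ge_of_sum_nonneg d' hs'
    rw [hnorm, inner_intVec_coord, hc, hc, hc] at h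
    simp only [hcpInt, Finset.mem_insert, Finset.mem_singleton] at hv
    rcases hv with rfl | rfl | rfl | rfl | rfl | rfl | rfl | rfl | rfl | rfl | rfl | rfl <;>
      simp only [Matrix.cons_val_zero, Matrix.cons_val_one, Matrix.cons_val_two, Matrix.head_cons, Matrix.tail_cons,
        Int.cast_ofNat, Int.cast_neg, Int.cast_zero, Int.cast_one] at h hvs
    -- hexagonal vectors are fixed by the reflection
    · exact ⟨![3, -3, 0], by decide, by rw [inner_intVec_coord]; simp; linarith⟩
    · exact ⟨![-3, 3, 0], by decide, by rw [inner_intVec_coord]; simp; linarith⟩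
    · exact ⟨![3, 0, -3], by decide, by rw [inner_intVec_coord]; simp; linarith⟩
    · exact ⟨![-3, 0, 3], by decide, by rw [inner_intVec_coord]; simp; linarith⟩
    · exact ⟨![0, 3, -3], by decide, by rw [inner_intVec_coord]; simp; linarith⟩
    · exact ⟨![0, -3, 3], by decide, by rw [inner_intVec_coord]; simp; linarith⟩
    -- the upper triangle maps to the lower one
    · exact ⟨![-1, -1, -4], by decide, by rw [inner_intVec_coord]; simp; linarith⟩
    · exact ⟨![-1, -4, -1], by decide, by rw [inner_intVec_coord]; simp; linarith⟩
    · exact ⟨![-4, -1, -1], by decide, by rw [inner_intVec_coord]; simp; linarith⟩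
    -- the lower triangle has negative coordinate sum (excluded by `hvs`)
    · norm_num at hvs
    · norm_num at hvs
    · norm_num at hvs

/-- `√18 = 3·√2`. -/
private theorem sqrt_eighteen : Real.sqrt 18 = 3 * Real.sqrt 2 := by
  rw [show (18 : ℝ) = 3 ^ 2 * 2 by norm_num, Real.sqrt_mul (by norm_num), Real.sqrt_sq (by norm_num)]

/-- **CAP LEMMA, HCP**: the anticuboctahedral kissing pattern meets every closed cap of angular radius `45°`. -/
theorem exists_mem_hcpKissingPattern_inner_ge (d : E3) :
    ∃ w ∈ hcpKissingPattern, ‖d‖ ≤ Real.sqrt 2 * ⟪d, w⟫ := by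
  obtain ⟨v, hv, h⟩ := exists_hcpInt_inner_ge d
  have hmem : (Real.sqrt ((18 : ℕ) : ℝ))⁻¹ • intVec v ∈ hcpKissingPattern := Finset.mem_image_of_mem _ hv
  rw [Nat.cast_ofNat] at hmem
  refine ⟨_, hmem, ?_⟩
  have h2 : (0 : ℝ) < Real.sqrt 2 := by positivity
  rw [real_inner_smul_right, ← mul_assoc, sqrt_eighteen, mul_inv, ← mul_assoc, mul_comm (Real.sqrt 2) 3⁻¹,
    mul_assoc 3⁻¹, mul_inv_cancel₀ h2.ne', mul_one]
  linarith

/-- Both patterns, as used by `ChartedAt`. -/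
theorem exists_mem_pattern_inner_ge {P : Finset E3} (hP : P = fccKissingPattern ∨ P = hcpKissingPattern) (d : E3) :
    ∃ w ∈ P, ‖d‖ ≤ Real.sqrt 2 * ⟪d, w⟫ := by
  rcases hP with rfl | rfl
  · exact exists_mem_fccKissingPattern_inner_ge d
  · exact exists_mem_hcpKissingPattern_inner_ge d

end cap

end Summit.AtomisticToContinuum.Crystallization.Theorems.ChargedEnergyGapChartDial

end
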